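import Literature.AlgebraicGeometry.HodgeTheory.AlgebraicCechDeRhamPullback
import Literature.AlgebraicGeometry.HodgeTheory.ConjRealizeClosedProofs
import Literature.AlgebraicGeometry.HodgeTheory.RationallyNormalisedDeRhamFamily
import Literature.NumberTheory.Transcendental.DeRhamTheoremProofs
import HarnessLib

/-!
# Conjugate classes on a smooth projective variety from the analytic half of Route P

[topic AlgebraicGeometry/HodgeTheory]

The tree proves the existence of `σ`-conjugate classes (`IsConjugateClass σ X k c c'`, the existence
conjunct of `IsAbsoluteHodgeClass`, [CharlesSchnell2014Notes, §11.2.2 (11.2.3)]) for a smooth projective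
`X` from four printed inputs (`ConjugationChartExistence.exists_isConjugateClass_of_facts`): (J)
Jouanolou's affine torsor `π : Y ⟶ X` with `π^*`, `(π^σ)^*` bijective (`jouanolou_cohomologyChart_holds`),
(R) a natural rationally normalised de Rham isomorphism family (`exists_isRational_complexDeRhamIsoFamily_holds`),
(C) conjugation preserves closed realisations (`conj_realize_mem_cclosedSmoothForms_holds`) — all three
theorems — and (G) Grothendieck's comparison `grothendieck_comparison_realize_surjective` for ALL smooth
affine `Y`, still a NAMED FACT (its printed proof needs resolution of singularities). Grothendieck
himself remarks [Grothendieck1966, p. 96] that for a COMPLETE `X` the comparison is elementary (spectral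
sequence of an affine cover + GAGA); the lane's Route P (`HodgeTheory/AlgebraicCechDeRham*`) follows that
road, and its torsor step (`HodgeTheory/AlgebraicCechDeRhamPullback`,
`exists_realize_eq_of_surjective_realizeDeRham`) yields (G) for the torsor `Y` from two inputs: the
realisation map `realizeDeRham : Hᵏ(Tot Č(𝔘, Ω•_alg)) → H^k_dR(X^an; ℂ)` of a finite affine cover of `X`
being ONTO (the analytic half: GAGA on `E₁` and the Dolbeault comparison, nodes P3–P4), and `(π^an)^*`
being onto on complex de Rham cohomology.

* `AnalyticModel.surjective_map_anMap_of_surjective_complexBetti_map` — **(J) in de Rham form**: for a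
  `ℂ`-morphism `h : Y ⟶ X` of smooth `ℂ`-schemes with analytic models on possibly DIFFERENT model spaces,
  `h^*` onto on `Hᵏ(–(ℂ); ℂ)` implies `(h^an)^*` onto on `H^k_dR(–; ℂ)`, by de Rham's theorem natural ACROSS
  model spaces (the complexified integration isomorphisms, `integrationDeRhamIsoFamily_complexify_natural₂`,
  [LeeSmoothManifolds2013, Thm. 18.14]) and `ψ_X ∘ h^an = h(ℂ) ∘ ψ_Y` (`AnalyticModel.pullback_map_eq`);
* **`exists_isConjugateClass_of_surjective_realizeDeRham`** — for `X` smooth projective with a finite affine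
  cover `𝔘`, charts `C`, analytic model `A`, IF `realizeDeRham` is onto in degree `k`, THEN every
  `c ∈ Hᵏ(X(ℂ); ℂ)` has a `σ`-conjugate class, for every `σ ∈ Aut ℂ`: the proof of
  `exists_isConjugateClass_of_facts` with (G) replaced by the torsor step of Route P on Jouanolou's `Y`.

So the existence of conjugate classes on a smooth projective `X` (lane row V-B2″) is reduced to ONE
analytic statement about `X^an` — the surjectivity of the realisation map — with no resolution of
singularities and no appeal to (G). Everything is proved; no definitions, no named facts (net debt 0).

## References

* [CharlesSchnell2014Notes] F. Charles, C. Schnell, *Notes on absolute Hodge classes*, §11.2.2,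
  (11.2.1)–(11.2.3).
* [Grothendieck1966] A. Grothendieck, *On the de Rham cohomology of algebraic varieties*, Publ. Math.
  IHÉS 29 (1966), p. 96 (4)–(6) and the remark on complete `X`, Thm. 1′.
* [Jouanolou1973] J.-P. Jouanolou, *Une suite exacte de Mayer–Vietoris en K-théorie algébrique*,
  Lemme 1.5.
* [CattaniElZeinGriffithsLe2014] E. Cattani, F. El Zein, P. Griffiths, Lê D. T. (eds.), *Hodge Theory*,
  Princeton Math. Notes 49 (2014), Ch. 2 §2.9.2, p. 109.
* [LeeSmoothManifolds2013] J. M. Lee, *Introduction to Smooth Manifolds*, 2nd ed., Thm. 18.14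
  (naturality of the de Rham homomorphism).
* [BottTu1982Forms] R. Bott, L. W. Tu, *Differential Forms in Algebraic Topology*, §I.5.
-/

noncomputable section

universe u

open scoped Manifold ContDiff
open CategoryTheory AlgebraicGeometry Literature.Algebra.Homology

namespace Literature.AlgebraicGeometry.HodgeTheory

open Literature.NumberTheory.Transcendental Literature.Geometry.Kaehler
open Literature.AlgebraicTopology.SingularHomology

section DeRhamFormOfJ

variable {E : Type} [NormedAddCommGroup E] [NormedSpace ℂ E] [FiniteDimensional ℂ E] {m : ℕ}
  {E' : Type} [NormedAddCommGroup E'] [NormedSpace ℂ E'] [FiniteDimensional ℂ E'] {m' : ℕ}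
  {X Y : Motives.SchemeOver ℂ} [SmoothOfRelativeDimension m X.hom] [SmoothOfRelativeDimension m' Y.hom]

/-- **(J) in de Rham form.** For a `ℂ`-morphism `h : Y ⟶ X` of smooth `ℂ`-schemes with analytic
models `B` of `Y` and `A` of `X` (on possibly different model spaces), if `h^* : Hᵏ(X(ℂ); ℂ) → Hᵏ(Y(ℂ); ℂ)`
is onto then so is `(h^an)^* : H^k_dR(X^an; ℂ) → H^k_dR(Y^an; ℂ)` — by de Rham's theorem in its natural
form ACROSS model spaces (the complexified integration isomorphisms,
`integrationDeRhamIsoFamily_complexify_natural₂`) and `ψ_X ∘ h^an = h(ℂ) ∘ ψ_Y`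
(`AnalyticModel.pullback_map_eq`). [cite: LeeSmoothManifolds2013, Thm. 18.14] [cite: BottTu1982Forms, §I.5] -/
theorem AnalyticModel.surjective_map_anMap_of_surjective_complexBetti_map (B : AnalyticModel E' m' Y)
    (A : AnalyticModel E m X) (h : Y ⟶ X) (k : ℕ)
    (hs : Function.Surjective (complexBetti.map h k)) :
    Function.Surjective (complexDeRhamCohomology.map E' (B.contMDiff_anMap A h) k) := by
  haveI : FiniteDimensional ℝ E := FiniteDimensional.complexToReal E
  haveI : FiniteDimensional ℝ E' := FiniteDimensional.complexToReal E'
  intro y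
  obtain ⟨t, ht⟩ := B.pullback_surjective k ((integrationDeRhamIsoFamily E').complexify B.carrier k y)
  obtain ⟨u, rfl⟩ := hs t
  refine ⟨((integrationDeRhamIsoFamily E).complexify A.carrier k).symm (A.pullback k u),
    ((integrationDeRhamIsoFamily E').complexify B.carrier k).injective ?_⟩
  rw [integrationDeRhamIsoFamily_complexify_natural₂ (B.contMDiff_anMap A h) k,
    LinearEquiv.apply_symm_apply, ← ht]
  exact (B.pullback_map_eq A h u).symm

end DeRhamFormOfJ

section ConjugateClasses

variable {n : ℕ} {X : Motives.SchemeOver ℂ} {ι : Type u} {U : ι → X.left.Opens}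
  {E : Type} [NormedAddCommGroup E] [NormedSpace ℂ E] [FiniteDimensional ℂ E]

/-- **Conjugate classes exist from the analytic half of Route P.** Let `X` be smooth projective over
`ℂ`, `𝔘` a finite affine open cover with charts `C`, `A` an analytic model of `X`, and suppose the
realisation map `realizeDeRham : Hᵏ(Tot Č(𝔘, Ω•_alg)) → H^k_dR(X^an; ℂ)` is ONTO (Route P nodes P3–P4:
GAGA on `E₁` and the Dolbeault comparison). Then for every `σ ∈ Aut ℂ` and `c ∈ Hᵏ(X(ℂ); ℂ)` there is
`c' ∈ Hᵏ(X^σ(ℂ); ℂ)` conjugate to `c` (`IsConjugateClass`, the existence conjunct of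
`IsAbsoluteHodgeClass`): the argument of `exists_isConjugateClass_of_facts` [CharlesSchnell2014Notes,
§11.2.2 (11.2.3)] with Grothendieck's (G) REPLACED by the torsor step of Route P
(`exists_realize_eq_of_surjective_realizeDeRham`) on Jouanolou's affine `π : Y ⟶ X`
(`jouanolou_cohomologyChart_holds`, in de Rham form by
`AnalyticModel.surjective_map_anMap_of_surjective_complexBetti_map`), with (R)
`exists_isRational_complexDeRhamIsoFamily_holds` and (C) `conj_realize_mem_cclosedSmoothForms_holds` —
no resolution of singularities and no appeal to (G). [cite: CharlesSchnell2014Notes, §11.2.2 (11.2.3)]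
[cite: Grothendieck1966, p. 96 (4)–(6)] -/
theorem exists_isConjugateClass_of_surjective_realizeDeRham (hX : Motives.IsSmoothProjective n X)
    [Fintype ι] [IsAffineCover U] (hU : ⨆ i, U i = ⊤) (C : CoverCharts X U) (A : AnalyticModel E n X)
    (k : ℕ) (hP : Function.Surjective (fun c : NatCochain.Cohomology C.cechDeRhamℝ.totD k ↦
      haveI : SmoothOfRelativeDimension n X.hom := hX.smoothOfRelativeDimension
      localCohomologyEquivComplexDeRham k (C.realizeDeRham A hU k c)))
    (σ : ℂ ≃+* ℂ) (c : complexBetti X k) : ∃ c', IsConjugateClass σ X k c c' := by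
  haveI : SmoothOfRelativeDimension n X.hom := hX.smoothOfRelativeDimension
  obtain ⟨m, Y, _, _, π, hπ⟩ := jouanolou_cohomologyChart_holds hX
  obtain ⟨B⟩ := nonempty_analyticModel_of_isAffine m Y
  obtain ⟨B'⟩ := nonempty_analyticModel_of_isAffine m (Motives.conjugateVariety σ Y)
  obtain ⟨e, he, hr⟩ := exists_isRational_complexDeRhamIsoFamily_holds (Fin m → ℂ)
  -- (J) in de Rham form, the torsor step and `hP`: an algebraic form expression for `π^* c` on `Y^an`
  have hJ := B.surjective_map_anMap_of_surjective_complexBetti_map A π k (hπ k).1.2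
  obtain ⟨ξ, hξ, hx⟩ := exists_realize_eq_of_surjective_realizeDeRham C A B π hU k hP hJ
    ((e B.carrier k).symm (B.pullback k (complexBetti.map π k c)))
  -- its conjugate expression has closed realisation on `(Y^σ)^an`
  have hξ' : (ξ.conj σ).realize B' ∈ cclosedSmoothForms (Fin m → ℂ) B'.carrier k :=
    conj_realize_mem_cclosedSmoothForms_holds σ m Y (Fin m → ℂ) B B' k ξ hξ
  -- read the class of `ξ^σ` in `Hᵏ(Y^σ(ℂ); ℂ)` and descend it along `(π^σ)^*`
  obtain ⟨d, hd⟩ := B'.pullback_surjective k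
    (e B'.carrier k (complexDeRhamCohomology.mk (Fin m → ℂ) B'.carrier k ⟨_, hξ'⟩))
  obtain ⟨c', hc'⟩ := ((hπ k).2 σ).2 d
  refine ⟨c',
    { m := m, Y := Y, π := π, E := Fin m → ℂ, an := B, anConj := B', deRham := e
      deRham_isNatural := he, deRham_isRational := hr k, injective_map := ((hπ k).2 σ).1 },
    ξ, hξ, hξ', ?_, ?_⟩
  · show B.pullback k (complexBetti.map π k c) =
      e B.carrier k (complexDeRhamCohomology.mk (Fin m → ℂ) B.carrier k ⟨ξ.realize B, hξ⟩)
    rw [hx, LinearEquiv.apply_symm_apply]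
  · show B'.pullback k (complexBetti.map (conjHom σ π) k c') =
      e B'.carrier k (complexDeRhamCohomology.mk (Fin m → ℂ) B'.carrier k ⟨(ξ.conj σ).realize B', hξ'⟩)
    rw [hc', hd]

end ConjugateClasses

end Literature.AlgebraicGeometry.HodgeTheory

end
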